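import Mathlib
import HarnessLib
import Literature.Analysis.Fourier.FejerJacksonKernels

/-!
# Route `KLProgramme` — crux K3, child Counterterm under Δ23 / (R-I-min): the `2π`-periodic JACKSON KERNEL (part 1 of the smoothing layer)

Δ23 (p2 g6's Δ-INTERP, plan g11 STATUS l.1449/l.1461): the trigonometric INTERPOLANT of the flat-extended two-leg symbol has no volume-uniform
`C⁴` certificate at the top order (Kharshiladze–Lozinski).  Under the repair (R-I-min) the two-leg pieces become FUNCTIONS and child Counterterm
emits its `TrigPolyC4v` frame by an `L`-INDEPENDENT smoothing of fixed degree — «fixed point on FrameOK's tube»: the smoothing must be a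
self-map of the `C⁴` tube with constant ONE, which a POSITIVE kernel of mass one delivers.  This file is the one-dimensional kernel:

* §1 `cosMulCoeff`, `cosPoly_mul` — the product of two cosine polynomials is a cosine polynomial (product-to-sum), explicit coefficients;
* §2 `jker d s := J_d(s/2π)/(2π)` — the `2π`-periodic Jackson kernel built on `Literature.Analysis.Fourier.TrigApprox.jackson` (`J_d = F_d²/∫F_d²`):
  `jker_nonneg`, `jker_neg` (even), `jker_add_two_pi` / `jker_periodic`, `continuous_jker`, `fejer_two_pi` (Fejér's kernel as `Σ_{h≤d} fejerCoeff d h cos(hs)`),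
  **`jker_eq_cosPoly`** (`J̃_d = Σ_{m ≤ 2d} jkerCoeff d m · cos(m s)` — a cosine polynomial of degree `2d`), **`integral_jker`** (`∫_{−π}^{π} J̃_d = 1`),
  `jackson_le_const` (`J_d ≤ π⁴(d+1)/8`) and the first-moment majorant **`abs_mul_jackson_le`** (`|x|·J_d(x) ≤ (π⁴/4)/(1 + ((d+1)x)²)` on `|x| ≤ ½`,
  from the tree's `jackson_le_inv` tail `≤ π⁴/(128(d+1)³x⁴)`), which gives the `O(1/(d+1))` first absolute moment downstream.

Pure real analysis (no model content); consumed by `…CountertermJacksonFrame` (the 2D smoothing operator as a `TrigPolyC4v`, its sup-Fréchet bounds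
with constant one and its value error).  Seat hubbard-kl-k3c3-p2 (g3).  References: Travaglini 2014 §7.1 (Jackson kernel), DeVore–Lorentz Ch. 7;
HOME/hubbard-kl-k3c3-p2/DELTA23-CHILD2.md.
-/

noncomputable section

namespace Summit.HubbardSuperconductivity.HubbardSuperconductivity.Theorems.KLRegimeSplit

set_option linter.dupNamespace false -- summit = problem name (single-conjunct summit), D-0017

open Real Finset MeasureTheory intervalIntegral
open Literature.Analysis.Fourier.TrigApprox

/-! ## §1 Products of cosine polynomials -/

/-- The coefficients of the product of two cosine polynomials `(Σ_{k≤N} a_k cos(kx))·(Σ_{l≤N'} b_l cos(lx))`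
(product-to-sum: `cos a cos b = ½(cos(a+b) + cos(a−b))`). -/
def cosMulCoeff (N N' : ℕ) (a b : ℕ → ℝ) (m : ℕ) : ℝ :=
  ∑ k ∈ range (N + 1), ∑ l ∈ range (N' + 1),
    a k * b l / 2 * ((if k + l = m then 1 else 0) + (if Int.natAbs ((k : ℤ) - l) = m then 1 else 0))

/-- **Product of cosine polynomials** is a cosine polynomial of the summed degree, with coefficients `cosMulCoeff`. -/
theorem cosPoly_mul (N N' : ℕ) (a b : ℕ → ℝ) (x : ℝ) :
    (∑ k ∈ range (N + 1), a k * Real.cos (k * x)) * (∑ l ∈ range (N' + 1), b l * Real.cos (l * x)) =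
      ∑ m ∈ range (N + N' + 1), cosMulCoeff N N' a b m * Real.cos (m * x) := by
  -- expand the right-hand side and swap the sums
  have hR : ∑ m ∈ range (N + N' + 1), cosMulCoeff N N' a b m * Real.cos (m * x) =
      ∑ k ∈ range (N + 1), ∑ l ∈ range (N' + 1),
        a k * b l / 2 * (Real.cos ((k + l : ℕ) * x) + Real.cos ((Int.natAbs ((k : ℤ) - l) : ℕ) * x)) := by
    unfold cosMulCoeff
    simp_rw [Finset.sum_mul]
    rw [Finset.sum_comm]
    refine Finset.sum_congr rfl fun k hk => ?_
    rw [Finset.sum_comm]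
    refine Finset.sum_congr rfl fun l hl => ?_
    have hk' := mem_range.mp hk
    have hl' := mem_range.mp hl
    have hmem1 : k + l ∈ range (N + N' + 1) := mem_range.mpr (by omega)
    have hmem2 : Int.natAbs ((k : ℤ) - l) ∈ range (N + N' + 1) := mem_range.mpr (by omega)
    simp_rw [mul_add, add_mul, Finset.sum_add_distrib, mul_assoc, ← Finset.mul_sum]
    congr 1
    · congr 1
      rw [show (∑ i ∈ range (N + N' + 1), (if k + l = i then (1:ℝ) else 0) * Real.cos (i * x)) =
          ∑ i ∈ range (N + N' + 1), (if k + l = i then Real.cos (i * x) else 0) from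
          Finset.sum_congr rfl fun i _ => by split_ifs <;> simp]
      rw [Finset.sum_ite_eq]
      simp [hmem1]
    · congr 1
      rw [show (∑ i ∈ range (N + N' + 1), (if Int.natAbs ((k : ℤ) - l) = i then (1:ℝ) else 0) * Real.cos (i * x)) =
          ∑ i ∈ range (N + N' + 1), (if Int.natAbs ((k : ℤ) - l) = i then Real.cos (i * x) else 0) from
          Finset.sum_congr rfl fun i _ => by split_ifs <;> simp]
      rw [Finset.sum_ite_eq]
      simp [hmem2]
  rw [hR, Finset.sum_mul_sum]
  refine Finset.sum_congr rfl fun k _ => Finset.sum_congr rfl fun l _ => ?_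
  have habs : Real.cos ((Int.natAbs ((k : ℤ) - l) : ℕ) * x) = Real.cos (((k : ℝ) - l) * x) := by
    rcases le_total l k with h | h
    · have : (Int.natAbs ((k : ℤ) - l) : ℕ) = k - l := by omega
      rw [this]; push_cast [h]; rfl
    · have : (Int.natAbs ((k : ℤ) - l) : ℕ) = l - k := by omega
      rw [this, ← Real.cos_neg]; push_cast [h]; ring_nf
  rw [habs]
  push_cast
  rw [Real.cos_add_cos]
  have e1 : ((k + l : ℝ) * x + (k - l) * x) / 2 = k * x := by ring
  have e2 : ((k + l : ℝ) * x - (k - l) * x) / 2 = l * x := by ring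
  rw [e1, e2]; ring

/-! ## §2 The `2π`-periodic Jackson kernel -/

/-- Fejér's kernel (order `d`, `2π` convention) as a cosine polynomial: the coefficient of `cos(h s)`. -/
def fejerCoeff (d : ℕ) (h : ℕ) : ℝ := if h = 0 then 1 else 2 * ((d + 1 : ℝ) - h) / (d + 1)

/-- Re-indexing `Σ_{h ∈ [1,d]} f h = Σ_{k < d} f (k+1)`. -/
theorem sum_Icc_one_eq_sum_range (f : ℕ → ℝ) (d : ℕ) :
    ∑ h ∈ Icc 1 d, f h = ∑ k ∈ range d, f (k + 1) := by
  induction d with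
  | zero => simp
  | succ d ih => rw [Finset.sum_Icc_succ_top (by omega), ih, Finset.sum_range_succ]

/-- `F_d(s/2π) = Σ_{h ≤ d} fejerCoeff d h · cos(h s)` (from `fejer_eq`). -/
theorem fejer_two_pi (d : ℕ) (s : ℝ) :
    fejer d (s / (2 * π)) = ∑ h ∈ range (d + 1), fejerCoeff d h * Real.cos (h * s) := by
  rw [fejer_eq, Finset.sum_range_succ', sum_Icc_one_eq_sum_range, Finset.mul_sum]
  have h0 : fejerCoeff d 0 * Real.cos (((0 : ℕ) : ℝ) * s) = 1 := by simp [fejerCoeff]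
  rw [h0, add_comm]
  congr 1
  refine Finset.sum_congr rfl fun k _ => ?_
  have h2π : (2 * π : ℝ) ≠ 0 := by positivity
  have hk : fejerCoeff d (k + 1) = 2 * ((d + 1 : ℝ) - (k + 1 : ℕ)) / (d + 1) := by
    simp [fejerCoeff]
  rw [hk, show 2 * π * ((k + 1 : ℕ) : ℝ) * (s / (2 * π)) = ((k + 1 : ℕ) : ℝ) * s by field_simp]
  field_simp

/-- **The `2π`-periodic Jackson kernel** of order `d`: `J̃_d(s) := J_d(s/2π)/(2π)` (`J_d = F_d²/∫F_d²` the period-`1` Jackson kernel of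
`Literature.Analysis.Fourier.TrigApprox`) — a nonnegative even cosine polynomial of degree `2d` with `∫_{−π}^{π} J̃_d = 1`. -/
def jker (d : ℕ) (s : ℝ) : ℝ := jackson d (s / (2 * π)) / (2 * π)

/-- The cosine coefficients of `J̃_d`. -/
def jkerCoeff (d : ℕ) (m : ℕ) : ℝ := cosMulCoeff d d (fejerCoeff d) (fejerCoeff d) m / (jacksonConst d * (2 * π))

/-- `J̃_d ≥ 0`. -/
theorem jker_nonneg (d : ℕ) (s : ℝ) : 0 ≤ jker d s := div_nonneg (jackson_nonneg d _) (by positivity)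

/-- `J̃_d` is even. -/
theorem jker_neg (d : ℕ) (s : ℝ) : jker d (-s) = jker d s := by
  unfold jker; rw [neg_div, jackson_neg]

/-- `J̃_d` is `2π`-periodic. -/
theorem jker_add_two_pi (d : ℕ) (s : ℝ) : jker d (s + 2 * π) = jker d s := by
  unfold jker
  have h2π : (2 * π : ℝ) ≠ 0 := by positivity
  have : (s + 2 * π) / (2 * π) = s / (2 * π) + ((1 : ℤ) : ℝ) := by push_cast; field_simp
  rw [this, jackson_add_int]

/-- `J̃_d` is `2π`-periodic (as `Function.Periodic`). -/
theorem jker_periodic (d : ℕ) : Function.Periodic (jker d) (2 * π) := fun s => jker_add_two_pi d s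

/-- `J̃_d` is continuous. -/
theorem continuous_jker (d : ℕ) : Continuous (jker d) := by
  unfold jker; exact ((continuous_jackson d).comp (continuous_id.div_const _)).div_const _

/-- **`J̃_d` as a cosine polynomial of degree `2d`.** -/
theorem jker_eq_cosPoly (d : ℕ) (s : ℝ) :
    jker d s = ∑ m ∈ range (d + d + 1), jkerCoeff d m * Real.cos (m * s) := by
  unfold jker jackson jkerCoeff
  rw [sq, fejer_two_pi, cosPoly_mul, div_div, Finset.sum_div]
  exact Finset.sum_congr rfl fun m _ => by ring

/-- **Mass one on a period**: `∫_{−π}^{π} J̃_d = 1`. -/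
theorem integral_jker (d : ℕ) : ∫ s in (-π)..π, jker d s = 1 := by
  have h2π : (2 * π : ℝ) ≠ 0 := by positivity
  have hper : Function.Periodic (jackson d) 1 := fun x => by
    simpa using jackson_add_int d x 1
  unfold jker
  rw [intervalIntegral.integral_div, intervalIntegral.integral_comp_div (fun x => jackson d x) h2π]
  rw [show -π / (2 * π) = -(1 / 2 : ℝ) by field_simp, show π / (2 * π) = -(1 / 2 : ℝ) + 1 by field_simp; ring]
  rw [hper.intervalIntegral_add_eq (-(1 / 2 : ℝ)) 0, zero_add, integral_jackson]
  simp [h2π]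

/-- The uniform bound `J_d ≤ π⁴(d+1)/8` (from `F_d ≤ d+1` and `∫F_d² ≥ 8(d+1)/π⁴`). -/
theorem jackson_le_const (d : ℕ) (x : ℝ) : jackson d x ≤ π ^ 4 * (d + 1) / 8 := by
  unfold jackson
  have hc := jacksonConst_ge d
  have hcpos := jacksonConst_pos d
  have hF := fejer_le d x
  have hF0 := fejer_nonneg d x
  rw [div_le_iff₀ hcpos]
  have h1 : fejer d x ^ 2 ≤ (d + 1 : ℝ) ^ 2 := pow_le_pow_left₀ hF0 hF 2
  calc fejer d x ^ 2 ≤ (d + 1 : ℝ) ^ 2 := h1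
    _ = π ^ 4 * (d + 1) / 8 * (8 * (d + 1) / π ^ 4) := by field_simp
    _ ≤ π ^ 4 * (d + 1) / 8 * jacksonConst d := by gcongr

/-- The pointwise first-moment majorant: `|x|·J_d(x) ≤ (π⁴/4)/(1 + ((d+1)x)²)` on `|x| ≤ 1/2`. -/
theorem abs_mul_jackson_le (d : ℕ) {x : ℝ} (hx : |x| ≤ 1 / 2) :
    |x| * jackson d x ≤ (π ^ 4 / 4) / (1 + ((d + 1) * x) ^ 2) := by
  have hJ0 := jackson_nonneg d x
  have hd : (0 : ℝ) < d + 1 := by positivity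
  have hπ4 : (0 : ℝ) < π ^ 4 := by positivity
  rw [le_div_iff₀ (by positivity)]
  set y := (d + 1) * |x| with hy
  have hy0 : 0 ≤ y := by positivity
  have hysq : ((d + 1) * x) ^ 2 = y ^ 2 := by rw [hy, mul_pow, mul_pow, sq_abs]
  rw [hysq]
  rcases le_or_gt y 1 with h1 | h1
  · -- near the origin: `J ≤ π⁴(d+1)/8`
    have hJ := jackson_le_const d x
    calc |x| * jackson d x * (1 + y ^ 2) ≤ |x| * (π ^ 4 * (d + 1) / 8) * (1 + 1) := by
          gcongr; nlinarith
      _ = π ^ 4 / 4 * y := by rw [hy]; ring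
      _ ≤ π ^ 4 / 4 := by nlinarith
  · -- tail: `J ≤ π⁴/(128 (d+1)³ x⁴)`
    have hx0 : x ≠ 0 := by
      intro h0; rw [h0, abs_zero, mul_zero] at hy; rw [hy] at h1; linarith
    have hJ := jackson_le_inv d hx0 hx
    have hxpos : 0 < |x| := abs_pos.mpr hx0
    have hx4 : x ^ 4 = |x| ^ 4 := (Even.pow_abs (by decide) x).symm
    have key : |x| * jackson d x * (1 + y ^ 2) ≤ |x| * (π ^ 4 / (128 * (d + 1) ^ 3 * x ^ 4)) * (1 + y ^ 2) := by
      gcongr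
    have hy3 : (d + 1 : ℝ) ^ 3 * |x| ^ 3 = y ^ 3 := by rw [hy]; ring
    have : |x| * (π ^ 4 / (128 * (d + 1) ^ 3 * x ^ 4)) * (1 + y ^ 2) = π ^ 4 * (1 + y ^ 2) / (128 * y ^ 3) := by
      rw [hx4, ← hy3]; field_simp
    rw [this] at key
    have hy1 : 1 < y := h1
    have hyy : (1 + y ^ 2) * 4 ≤ 128 * y ^ 3 := by nlinarith [sq_nonneg y, mul_pos (by linarith : (0:ℝ) < y) (by nlinarith : (0:ℝ) < y ^ 2)]
    have hfrac : π ^ 4 * (1 + y ^ 2) / (128 * y ^ 3) ≤ π ^ 4 / 4 := by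
      rw [div_le_div_iff₀ (by positivity) (by positivity)]
      nlinarith [mul_le_mul_of_nonneg_left hyy hπ4.le]
    exact key.trans hfrac

end Summit.HubbardSuperconductivity.HubbardSuperconductivity.Theorems.KLRegimeSplit

end
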